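import Literature.NumberTheory.GaloisRepresentations.IdeleTruncation
import Literature.NumberTheory.GaloisRepresentations.GalLayerSystemHom
import HarnessLib

/-!
# The truncation on `J̄ = lim→_E J_E` and `I_S` as the truncation of the `N_S`-invariants of `J̄`
# (Harari, *Galois Cohomology and CFT*, §17.4 (17.1))

Topic `NumberTheory/GaloisRepresentations`; namespaces `Literature.NumberTheory.GaloisRepresentations.IdeleHerbrand` (§1)
and `Literature.NumberTheory.GaloisRepresentations.IdeleClassBar` (§2–§3); a sequel to `IdeleTruncation.lean` (the
finite-level truncation `x ↦ x^{(S)}`) and `IdeleTruncatedS.lean` (`I_S = truncIdeleBar K S ≤ J̄`).  Definitions with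
bodies and theorems; NO named fact, no `sorry`, no instance, no notation; number fields in `Type`.

THE POINT.  The truncation is compatible with base change (§1), hence a morphism of door-c5's layer system
`ideleData K → ideleData K` (§2, `truncHomData`), whose limit `truncBar K S : J̄ →+ J̄` is a `Γ_K`-equivariant idempotent
projector.  §3: every `N_S`-invariant element of `J̄` comes from a layer INSIDE `K_S` (the layer `K̄^{U_M · N_S}` of the
open normal subgroup generated by `U_M` and `N_S`, as in -w3 g17's `exists_layer_insideKS_of_forall_mem` for `C̄`), so
`truncBar` maps `J̄^{N_S}` INTO `I_S` and is the identity on `I_S`: **`I_S = truncBar (J̄^{N_S})`** — the global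
description of Harari's `I_S` from which the unit embedding `E_S = (lim Eˣ)^{N_S} → I_S` of (17.1) is
`truncBar ∘ unitsToIdele`.

## What is formalised (`K : Type` a number field, `S : Finset (HeightOneSpectrum (𝓞 K))`)

* §1 `IdeleHerbrand.ideleBaseChange_truncOf` (`(x^{(S)})_{E'} = (x_{E'})^{(S)}`).
* §2 **`IdeleClassBar.truncHomData K S : (ideleData K).Hom (ideleData K)`**, **`truncBar K S : J̄ →+ J̄`** (`limitMap`),
  `truncBar_of`, `truncBar_rep` (equivariance), `truncBar_truncBar` (idempotent), `truncBar_eq_self_of_mem`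
  (identity on `I_S`).
* §3 **`exists_layer_insideKS_of_forall_rep_eq`** (`z ∈ J̄^{N_S}` comes from a layer inside `K_S`),
  **`truncBar_mem_truncIdeleBar`** (`z ∈ J̄^{N_S} ⇒ truncBar z ∈ I_S`), **`mem_truncIdeleBar_iff_exists_truncBar`**
  (`I_S = truncBar (J̄^{N_S})`).

Written for lane «PT-Ш-S-TC» (brick D3) of crux `GoodLatticeBDPValue` (cell bsd-eis, item 19032), seat bsd-line-x1-p1-w6
gen 10.  HONEST FRAMING: bookkeeping; no arithmetic statement and no case of BSD is proved here.

## References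
* D. Harari, *Galois Cohomology and Class Field Theory*, Universitext, Springer (2020), §17.4 (17.1), Def. 17.22,
  Lemma 17.23. [Harari2020]
* J. W. S. Cassels, A. Fröhlich (eds.), *Algebraic Number Theory* (1967), Ch. VII (J. Tate) §8 Prop. 8.1, §9.7. [CasselsFrohlichANT1967]
-/

noncomputable section

open NumberField IsDedekindDomain
open Field (absoluteGaloisGroup)
open Literature.NumberTheory.Automorphic Literature.Algebra.Homology
open scoped Classical

namespace Literature.NumberTheory.GaloisRepresentations

/-! ## §1. Truncation commutes with base change -/

namespace IdeleHerbrand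

variable {F : Type} [Field F] [NumberField F] {E : Type} [Field E] [NumberField E] [Algebra F E]
variable {E' : Type} [Field E'] [NumberField E'] [Algebra E E'] [Algebra F E'] [IsScalarTower F E E']

omit [NumberField F] in
/-- **`(x^{(S)})_{E'} = (x_{E'})^{(S)}`**: base change commutes with truncation (a place `w'` of `E'` lies above `S` iff
the place `w' ∩ E` does, and `ι(1) = 1`). [cite: Harari2020, §17.4 (17.1)] -/
theorem ideleBaseChange_truncOf (S : Finset (HeightOneSpectrum (𝓞 F))) (x : ideleGroup E) :
    AdeleRing.ideleBaseChange E E' (truncOf S x) = truncOf S (AdeleRing.ideleBaseChange E E' x) := by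
  apply Units.ext
  refine Prod.ext ?_ (FiniteAdeleRing.ext E' fun w' => ?_)
  · rw [AdeleRing.coe_ideleBaseChange, AdeleRing.baseChange_fst, truncOf_fst, truncOf_fst,
      AdeleRing.coe_ideleBaseChange, AdeleRing.baseChange_fst]
  · haveI : w'.asIdeal.LiesOver (w'.under (𝓞 E)).asIdeal := ⟨rfl⟩
    rw [AdeleRing.coe_ideleBaseChange, AdeleRing.baseChange_snd, FiniteAdeleRing.baseChange_apply,
      adicCompletionOfUnder_eq E w' rfl, truncOf_snd_apply, truncOf_snd_apply, AdeleRing.coe_ideleBaseChange,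
      AdeleRing.baseChange_snd, FiniteAdeleRing.baseChange_apply, adicCompletionOfUnder_eq E w' rfl,
      HeightOneSpectrum.under_under F E E' w']
    by_cases h : w'.under (𝓞 F) ∈ S
    · rw [if_pos h, if_pos h]
    · rw [if_neg h, if_neg h, map_one]

end IdeleHerbrand

/-! ## §2. The truncation on `J̄` -/

namespace IdeleClassBar

variable (K : Type) [Field K] [NumberField K] (S : Finset (HeightOneSpectrum (𝓞 K)))

/-- **The truncation as a morphism of the idèle layer system** (`E ↦ (x ↦ x^{(S)})` on `J_E`; equivariant by
`truncOf_smul`, compatible with base change by `ideleBaseChange_truncOf`). [cite: Harari2020, §17.4 (17.1)] -/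
def truncHomData : (ideleData K).Hom (ideleData K) where
  app E := haveI := E.numberField
    MonoidHom.toAdditive (α := ideleGroup E.1) (β := ideleGroup E.1) (IdeleHerbrand.truncMonoidHom K E.1 S)
  app_ρ E g x := by
    haveI := E.numberField
    exact congrArg Additive.ofMul (IdeleHerbrand.truncOf_smul S g (Additive.toMul x : ideleGroup E.1))
  base_app E E' h x := by
    haveI := E.numberField
    haveI := E'.numberField
    letI := GalLayer.algebraOfLE h
    haveI := GalLayer.isScalarTower_of_le h
    exact congrArg Additive.ofMul (IdeleHerbrand.ideleBaseChange_truncOf S (Additive.toMul x : ideleGroup E.1))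

/-- Formula on a layer: `truncHomData` is `x ↦ x^{(S)}`. [cite: Harari2020, §17.4 (17.1)] -/
theorem toMul_truncHomData_app (E : GalLayer K) (x : (ideleData K).V E) :
    (haveI := E.numberField; (Additive.toMul ((truncHomData K S).app E x) : ideleGroup E.1)) =
      (haveI := E.numberField; IdeleHerbrand.truncOf S (Additive.toMul x : ideleGroup E.1)) := rfl

/-- **The truncation `J̄ →+ J̄`** (limit of the layer truncations). [cite: Harari2020, §17.4 (17.1)] -/
def truncBar : (ideleData K).toSystem.limit →+ (ideleData K).toSystem.limit := (truncHomData K S).limitMap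

/-- `truncBar [x]_E = [x^{(S)}]_E`. [cite: Harari2020, §17.4 (17.1)] -/
theorem truncBar_of (E : GalLayer K) (x : (ideleData K).V E) :
    truncBar K S ((ideleData K).toSystem.of E x) = (ideleData K).toSystem.of E ((truncHomData K S).app E x) :=
  (truncHomData K S).limitMap_of E x

/-- **`truncBar` is `Γ_K`-equivariant.** [cite: Harari2020, §17.4 (17.1)] -/
theorem truncBar_rep (σ : absoluteGaloisGroup K) (z : (ideleData K).toSystem.limit) :
    truncBar K S ((ideleData K).toSystem.rep σ z) = (ideleData K).toSystem.rep σ (truncBar K S z) :=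
  (truncHomData K S).limitMap_rep σ z

/-- The image of `truncBar` on a layer class is the class of a truncated idèle. [cite: Harari2020, §17.4 (17.1)] -/
theorem toMul_truncHomData_app_mem (E : GalLayer K) (x : (ideleData K).V E) :
    haveI := E.numberField; (Additive.toMul ((truncHomData K S).app E x) : ideleGroup E.1) ∈
      IdeleHerbrand.truncIdeles K E.1 S := by
  haveI := E.numberField
  exact IdeleHerbrand.truncOf_mem S _

/-- **`truncBar` is idempotent.** [cite: Harari2020, §17.4 (17.1)] -/
theorem truncBar_truncBar (z : (ideleData K).toSystem.limit) : truncBar K S (truncBar K S z) = truncBar K S z := by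
  obtain ⟨E, x, rfl⟩ := (ideleData K).toSystem.exists_of z
  haveI := E.numberField
  rw [truncBar_of, truncBar_of]
  exact congrArg ((ideleData K).toSystem.of E) (congrArg Additive.ofMul
    (IdeleHerbrand.truncOf_truncOf S (Additive.toMul x : ideleGroup E.1)))

variable {K S} in
/-- **`truncBar` is the identity on `I_S`.** [cite: Harari2020, §17.4 (17.1)] -/
theorem truncBar_eq_self_of_mem {z : (ideleData K).toSystem.limit} (hz : z ∈ truncIdeleBar K S) :
    truncBar K S z = z := by
  obtain ⟨E, -, x, hx, rfl⟩ := mem_truncIdeleBar_iff.1 hz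
  haveI := E.numberField
  rw [truncBar_of]
  exact congrArg ((ideleData K).toSystem.of E) (congrArg Additive.ofMul (IdeleHerbrand.truncOf_eq_self S hx))

/-! ## §3. `I_S = truncBar (J̄^{N_S})` -/

variable {K S} in
/-- **An `N_S`-invariant element of `J̄` comes from a layer inside `K_S`**: `z = [y]_M` is fixed by the open normal
subgroup `W = U_M ⊔ N_S`, whose layer `K̄^W` lies inside `K_S` and carries `z` by Galois descent.
[cite: Harari2020, §17.4 (17.1)] [cite: CasselsFrohlichANT1967, Ch. VII §8 Prop. 8.1] -/
theorem exists_layer_insideKS_of_forall_rep_eq (z : (ideleData K).toSystem.limit)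
    (hz : ∀ σ ∈ ramificationSubgroup K (↑S : Set (HeightOneSpectrum (𝓞 K))), (ideleData K).toSystem.rep σ z = z) :
    ∃ (E : GalLayer K) (_ : ramificationSubgroup K (↑S : Set (HeightOneSpectrum (𝓞 K))) ≤
        (E.openNormalSubgroup : Subgroup (absoluteGaloisGroup K)))
      (x : (ideleData K).V E), (ideleData K).toSystem.of E x = z := by
  obtain ⟨M, y, rfl⟩ := (ideleData K).toSystem.exists_of z
  let W : OpenNormalSubgroup (absoluteGaloisGroup K) :=
    { toSubgroup := (M.openNormalSubgroup : Subgroup (absoluteGaloisGroup K)) ⊔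
          ramificationSubgroup K (↑S : Set (HeightOneSpectrum (𝓞 K)))
      isOpen' := Subgroup.isOpen_mono (le_sup_left (a := (M.openNormalSubgroup : Subgroup (absoluteGaloisGroup K))))
        M.openNormalSubgroup.toOpenSubgroup.isOpen
      isNormal' := Subgroup.sup_normal _ _ }
  have hW : (W : Subgroup (absoluteGaloisGroup K)) =
      (M.openNormalSubgroup : Subgroup (absoluteGaloisGroup K)) ⊔
        ramificationSubgroup K (↑S : Set (HeightOneSpectrum (𝓞 K))) := rfl
  refine ⟨GalLayer.ofOpenNormalSubgroup W, ?_, ?_⟩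
  · rw [GalLayer.openNormalSubgroup_ofOpenNormalSubgroup, hW]
    exact le_sup_right
  · refine (ideleData K).toSystem.exists_of_eq_of_forall_mem _ _ fun σ hσ => ?_
    have hσ' : σ ∈ ((GalLayer.ofOpenNormalSubgroup W).openNormalSubgroup : Subgroup (absoluteGaloisGroup K)) := hσ
    rw [GalLayer.openNormalSubgroup_ofOpenNormalSubgroup, hW] at hσ'
    have hle : (M.openNormalSubgroup : Subgroup (absoluteGaloisGroup K)) ⊔
        ramificationSubgroup K (↑S : Set (HeightOneSpectrum (𝓞 K))) ≤
          DiscreteRep.stabilizer (ideleData K).toSystem.toRep ((ideleData K).toSystem.of M y) :=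
      sup_le ((ideleData K).toSystem.openNormalSubgroup_le_stabilizer_of M y) fun τ hτ => hz τ hτ
    exact hle hσ'

variable {K S} in
/-- **`truncBar` maps `J̄^{N_S}` into `I_S`.** [cite: Harari2020, §17.4 (17.1)] -/
theorem truncBar_mem_truncIdeleBar {z : (ideleData K).toSystem.limit}
    (hz : ∀ σ ∈ ramificationSubgroup K (↑S : Set (HeightOneSpectrum (𝓞 K))), (ideleData K).toSystem.rep σ z = z) :
    truncBar K S z ∈ truncIdeleBar K S := by
  obtain ⟨E, hE, x, rfl⟩ := exists_layer_insideKS_of_forall_rep_eq z hz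
  rw [truncBar_of]
  exact of_mem_truncIdeleBar E hE (toMul_truncHomData_app_mem K S E x)

variable {K S} in
/-- **`I_S = truncBar (J̄^{N_S})`**: an element of `J̄` lies in `I_S` iff it is the truncation of an `N_S`-invariant
element (namely of itself). [cite: Harari2020, §17.4 (17.1)] -/
theorem mem_truncIdeleBar_iff_exists_truncBar {z : (ideleData K).toSystem.limit} :
    z ∈ truncIdeleBar K S ↔ ∃ y : (ideleData K).toSystem.limit,
      (∀ σ ∈ ramificationSubgroup K (↑S : Set (HeightOneSpectrum (𝓞 K))), (ideleData K).toSystem.rep σ y = y) ∧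
        truncBar K S y = z := by
  constructor
  · intro hz
    exact ⟨z, fun σ hσ => rep_eq_self_of_mem_ramificationSubgroup hσ hz, truncBar_eq_self_of_mem hz⟩
  · rintro ⟨y, hy, rfl⟩
    exact truncBar_mem_truncIdeleBar hy

end IdeleClassBar

end Literature.NumberTheory.GaloisRepresentations

end
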